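import Mathlib
import HarnessLib
import Literature.Analysis.FluidPDE.LocalTypeIBlowup.Normalization
import Literature.Analysis.FluidPDE.NSBoundedHigherRegularityQuantProofs
import Literature.Analysis.FluidPDE.HolderExtraction
import Literature.Analysis.FluidPDE.TaoEnstrophyLocalisation
import Literature.Analysis.FluidPDE.CKN1982Setting

/-!
# Blow-up at a local Type I singular point, file 11: vorticity (gradient) compactness of a
# bounded local blow-up sequence — smooth representatives, diagonal Arzelà–Ascoli, `C¹` limit

Analysis/FluidPDE proof file (theorems only: no definition, no named fact, no `sorry`), eleventh
file of the Literature port `LocalTypeIBlowup/*` of the blow-up procedure at a local Type I singular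
point (Seregin–Šverák 2009, §2 and Thm. 2.8; Albritton–Barker 2019, Prop. 2.4 and §3; assembled in
`AlbrittonBarkerForwardHolds.lean`). The assembly there extracts a strong `L³_loc` limit only
(`local_typeI_compactness`, file `Engine`); the geometric criteria that REASON ABOUT THE VORTICITY of
the blow-up limit (Giga–Miura 2011, Thm. 2.10 = the tree's named fact
`gigaMiura2011_local_continuousAlignment_typeI`; Barker–Prange 2020, Thm. 3 =
`barkerPrange2020_alignment_concentrating_typeI`) need the `C¹_loc` content of the printed
compactness step: Seregin–Šverák 2009, Thm. 2.8 (p. 7: "For each `a > 0`, the sequence `{u^k}`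
is uniformly Hölder continuous on the closure of `Q(a)` for sufficiently large `k` and a
subsequence `{u^{k_j}}` of `{u^k}` converges uniformly on compact subsets of `ℝⁿ × ]−∞, 0]` to a
mild bounded ancient solution `u` with `|u(0,0)| = 1`"), run together with the higher-derivative
bounds of its proof (cf. §2 p. 8: "for any natural `k`, `z = (x,t) ↦ ∇ᵏv(z)` is Hölder
continuous in `Q̄₂` … The corresponding norms are estimated by constants depending on `‖v‖_{3,Q}`,
`‖q‖_{3/2,Q}`, `‖v‖_{∞,Q₁}`, and numbers `k, r₁, r₂, a₂, τ₂`" — printed there for the annular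
cylinder of the axisymmetric setting; here the bounds come from the tree's
`NSBoundedHigherRegularityBounds_holds`), and Koch–Nadirashvili–Seregin–Šverák 2009, Lemma 6.1
(convergence of the derivatives). This file supplies it for a sequence of LOCAL
suitable weak solutions `(v k, q k)` on the growing parabolic balls `Q(0, 2ᵐ)`, `m ≤ k`, which are
uniformly bounded (`|v k| ≤ M` a.e. on `Q(0, 2ᵏ)`, as the point-picking normalisation of file
`Approximants` provides with `M = 1`) and have `𝐈(Q(0, 2ᵐ)) ≤ I < ∞`:

* `exists_pressure_level_bound` — the unit-ball-mean-free pressures are bounded in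
  `L^{3/2}(Q(0, 2ᵐ))` uniformly in `k ≥ m` (file `Normalization`);
* `exists_representatives` — by the tree's PROVED quantitative interior regularity
  `NSBoundedHigherRegularityBounds_holds` (Seregin–Šverák 2009, §2 p. 8) every `v k` has a
  representative `V k` on `Q(0, 2ᵏ)`, continuous with `C^∞` slices, and at every level `m` all
  `V k`, `k ≥ m + 1`, share one sup bound and one Hölder modulus for each `D_xⁿ V k` on `Q(0, 2ᵐ)`
  (two continuous representatives agree on the open ball, `Measure.eqOn_open_of_ae_eq`);
* `exists_subseq_fderiv_limit` — the diagonal Arzelà–Ascoli extraction of the tree's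
  `HolderExtraction.lean` applied twice (fields, then gradients, on the compact slab pieces
  exhausting `(−∞, 0) × ℝ³`), and `hasFDerivAt_of_tendstoLocallyUniformlyOn`: a subsequence
  converges pointwise on the open slab together with its gradients to a continuous `W` with
  differentiable slices;
* `ae_eq_limit_of_tendsto_eLpNorm` — the pointwise limit is the strong `L³` limit a.e.
  (a.e.-convergent sub-subsequences);
* `exists_subseq_curl_limit` — the assembled statement, with `curl V j(t)(x) → curl W(t)(x)` at
  every `t < 0`, `x` (the curl is a continuous linear function of the gradient, `curl_eq_curlCLM`).

Nothing here is a claim about Navier–Stokes regularity; no new notion is introduced.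

## References

* G. Seregin, V. Šverák, Comm. PDE 34 (2009) 171–201 = arXiv:0804.1803: Thm. 2.8 (p. 7, uniform
  convergence on compact subsets along the blow-up sequence) and its proof, §2 p. 8
  (higher-derivative Hölder bounds). [SereginSverak2009]
* G. Koch, N. Nadirashvili, G. Seregin, V. Šverák, Acta Math. 203 (2009) = arXiv:0709.3599,
  Lemma 6.1. [KochNadirashviliSereginSverak2009]
* D. Albritton, T. Barker, J. Math. Fluid Mech. 21 (2019) = arXiv:1811.00502, §3 (3.3).
  [AlbrittonBarker2019]
-/

noncomputable section

open MeasureTheory Set Function Filter Topology TopologicalSpace Metric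
open scoped NNReal ENNReal

namespace Literature.Analysis.FluidPDE.LocalTypeIBlowup

/-! ### Step 1: uniform `L^{3/2}` bounds of the normalised pressures at every level -/

/-- **Uniform `L^{3/2}` pressure bound at level `m`.** For a sequence `(v k, q k)` of suitable weak
solutions in the balls `Q(0, 2ᵐ)`, `m ≤ k`, with `𝐈(Q(0, 2ᵐ)) ≤ I < ∞`, the unit-ball-mean-free
pressures `q k − [q k]_{B(0,1)}` satisfy `∫_{Q(0,2ᵐ)} |·|^{3/2} ≤ P m` for all `k ≥ m`, with `P m`
depending on `m` and `I` only (Albritton–Barker 2019, §3, (3.3)). [cite: AlbrittonBarker2019, §3 (3.3)] -/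
theorem exists_pressure_level_bound {I : ℝ≥0∞} (hI : I < ⊤)
    {v : ℕ → ℝ → (EuclideanSpace ℝ (Fin 3)) → (EuclideanSpace ℝ (Fin 3))}
    {q : ℕ → ℝ → (EuclideanSpace ℝ (Fin 3)) → ℝ}
    {G : ℕ → ℝ → (EuclideanSpace ℝ (Fin 3)) → (EuclideanSpace ℝ (Fin 3)) →L[ℝ] (EuclideanSpace ℝ (Fin 3))}
    (hball : ∀ m k : ℕ, m ≤ k → IsSuitableWeakSolutionInBall ((2 : ℝ) ^ m) 0 (v k) (q k))
    (hbd : ∀ m k : ℕ, m ≤ k →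
      typeIBound (parabolicCylinder ((2 : ℝ) ^ m) (0 : ℝ × (EuclideanSpace ℝ (Fin 3)))) (v k) (q k) (G k) ≤ I)
    (m : ℕ) :
    ∃ P : ℝ≥0, ∀ k : ℕ, m ≤ k →
      ∫⁻ w in parabolicCylinder ((2 : ℝ) ^ m) (0 : ℝ × (EuclideanSpace ℝ (Fin 3))),
        ‖(q k w.1 w.2 - ⨍ y in ball (0 : (EuclideanSpace ℝ (Fin 3))) 1, q k w.1 y)‖ₑ ^ (3 / 2 : ℝ) ≤ P := by
  have hcc_pos : (0 : ℝ) < (2 : ℝ) ^ m := by positivity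
  have hcc_one : (1 : ℝ) ≤ (2 : ℝ) ^ m := one_le_pow₀ (by norm_num)
  set Cst : ℝ≥0∞ := 2 * (1 + volume (ball (0 : (EuclideanSpace ℝ (Fin 3))) ((2 : ℝ) ^ m)) *
      (volume (ball (0 : (EuclideanSpace ℝ (Fin 3))) 1))⁻¹) * (ENNReal.ofReal ((2 : ℝ) ^ m) ^ 2 * I)
    with hCst
  have hCst_top : Cst < ⊤ := by
    refine ENNReal.mul_lt_top ?_ (ENNReal.mul_lt_top (ENNReal.pow_lt_top ENNReal.ofReal_lt_top) hI)
    refine ENNReal.mul_lt_top (by simp) ?_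
    refine ENNReal.add_lt_top.2 ⟨ENNReal.one_lt_top, ENNReal.mul_lt_top measure_ball_lt_top ?_⟩
    exact ENNReal.inv_lt_top.2 (measure_ball_pos volume (0 : (EuclideanSpace ℝ (Fin 3))) one_pos)
  refine ⟨Cst.toNNReal, fun k hmk => ?_⟩
  set qn : ℝ → (EuclideanSpace ℝ (Fin 3)) → ℝ :=
    fun t x => q k t x - ⨍ y in ball (0 : (EuclideanSpace ℝ (Fin 3))) 1, q k t y with hqn
  have hballn : IsSuitableWeakSolutionInBall ((2 : ℝ) ^ m) 0 (v k) qn :=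
    isSuitableWeakSolutionInBall_sub_unitBallMean hcc_one (hball m k hmk)
  have h0 : ∀ t, ⨍ y in ball (0 : (EuclideanSpace ℝ (Fin 3))) 1, qn t y = 0 :=
    fun t => unitBallMean_normalised (q k) t
  have hD : cknDOsc ((2 : ℝ) ^ m) 0 qn ≤ I := by
    refine (cknDOsc_le_abScaledSum (u := v k) (G := G k)).trans ?_
    refine (abScaledSum_le_typeIBound hcc_pos Subset.rfl).trans ?_
    show typeIBound _ (v k) (fun t x => q k t x - ⨍ y in ball (0 : (EuclideanSpace ℝ (Fin 3))) 1, q k t y)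
      (G k) ≤ I
    rw [typeIBound_sub_unitBallMean_ball (hball m k hmk).2.2.2]
    exact hbd m k hmk
  have h1 := lintegral_pressure_ball_le hcc_one hballn.2.2.2.1 h0
  rw [ENNReal.coe_toNNReal hCst_top.ne]
  refine h1.trans ?_
  rw [hCst]
  gcongr

/-! ### Step 2: two continuous representatives on an open set agree there -/

/-- Two functions continuous on an open set of `ℝ × ℝ³` and a.e. equal there to a third one agree
on the set (Lebesgue measure charges open sets). [folklore] -/
private theorem eqOn_of_ae_eq_of_continuousOn {O : Set (ℝ × (EuclideanSpace ℝ (Fin 3)))} (hO : IsOpen O)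
    {f g h : ℝ × (EuclideanSpace ℝ (Fin 3)) → (EuclideanSpace ℝ (Fin 3))}
    (hf : h =ᵐ[volume.restrict O] f) (hg : h =ᵐ[volume.restrict O] g)
    (hfc : ContinuousOn f O) (hgc : ContinuousOn g O) : EqOn f g O :=
  Measure.eqOn_open_of_ae_eq (hf.symm.trans hg) hO hfc hgc

/-- Slices of an open subset of `ℝ × ℝ³` are open. [folklore] -/
private theorem isOpen_slice {O : Set (ℝ × (EuclideanSpace ℝ (Fin 3)))} (hO : IsOpen O) (t : ℝ) :
    IsOpen {x : (EuclideanSpace ℝ (Fin 3)) | (t, x) ∈ O} :=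
  hO.preimage (Continuous.prodMk_right t)

/-- If two curried fields agree on an open set of space–time, their spatial iterated derivatives
agree at its points. [folklore] -/
private theorem iteratedFDeriv_eq_of_eqOn {O : Set (ℝ × (EuclideanSpace ℝ (Fin 3)))} (hO : IsOpen O)
    {V V' : ℝ → (EuclideanSpace ℝ (Fin 3)) → (EuclideanSpace ℝ (Fin 3))}
    (h : EqOn (uncurry V) (uncurry V') O) {w : ℝ × (EuclideanSpace ℝ (Fin 3))} (hw : w ∈ O) (n : ℕ) :
    iteratedFDeriv ℝ n (V w.1) w.2 = iteratedFDeriv ℝ n (V' w.1) w.2 := by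
  have hev : V w.1 =ᶠ[𝓝 w.2] V' w.1 := by
    have hmem : {x : (EuclideanSpace ℝ (Fin 3)) | (w.1, x) ∈ O} ∈ 𝓝 w.2 :=
      (isOpen_slice hO w.1).mem_nhds (by simpa using hw)
    filter_upwards [hmem] with x hx
    exact h hx
  exact (hev.iteratedFDeriv ℝ n).eq_of_nhds

/-- Same for the spatial gradient. [folklore] -/
private theorem fderiv_eq_of_eqOn {O : Set (ℝ × (EuclideanSpace ℝ (Fin 3)))} (hO : IsOpen O)
    {V V' : ℝ → (EuclideanSpace ℝ (Fin 3)) → (EuclideanSpace ℝ (Fin 3))}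
    (h : EqOn (uncurry V) (uncurry V') O) {w : ℝ × (EuclideanSpace ℝ (Fin 3))} (hw : w ∈ O) :
    fderiv ℝ (V w.1) w.2 = fderiv ℝ (V' w.1) w.2 := by
  have hev : V w.1 =ᶠ[𝓝 w.2] V' w.1 := by
    have hmem : {x : (EuclideanSpace ℝ (Fin 3)) | (w.1, x) ∈ O} ∈ 𝓝 w.2 :=
      (isOpen_slice hO w.1).mem_nhds (by simpa using hw)
    filter_upwards [hmem] with x hx
    exact h hx
  exact hev.fderiv_eq


/-! ### Step 3: smooth representatives with level-uniform bounds -/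

/-- **Smooth representatives of a bounded local blow-up sequence, with uniform bounds at every
level** (cf. Seregin–Šverák 2009, proof of Thm. 2.8, §2 p. 8: "for any natural `k`,
`z = (x,t) ↦ ∇ᵏv(z)` is Hölder continuous in `Q̄₂` … The corresponding norms are estimated by
constants depending on `‖v‖_{3,Q}`, `‖q‖_{3/2,Q}`, `‖v‖_{∞,Q₁}`, and numbers `k, r₁, r₂, a₂, τ₂`";
here through the tree's `NSBoundedHigherRegularityBounds_holds`). Let `(v k, q k)` be
suitable weak solutions in `Q(0, 2ᵐ)` for `m ≤ k`, with `𝐈(Q(0, 2ᵐ)) ≤ I < ∞` and `|v k| ≤ M`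
a.e. on `Q(0, 2ᵏ)`. Then each `v k` has a representative `V k` on `Q(0, 2ᵏ)`, continuous with
`C^∞` slices, and for every level `m` all `V k`, `k ≥ m + 1`, obey ONE sup bound and ONE Hölder
modulus for each spatial derivative `D_xⁿ V k` on `Q(0, 2ᵐ)`.
[cite: SereginSverak2009, proof of Thm 2.8, §2 p. 8 (uniform higher-derivative Hölder bounds along the blow-up sequence)] -/
theorem exists_representatives {I : ℝ≥0∞} (hI : I < ⊤) {M : ℝ}
    {v : ℕ → ℝ → (EuclideanSpace ℝ (Fin 3)) → (EuclideanSpace ℝ (Fin 3))}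
    {q : ℕ → ℝ → (EuclideanSpace ℝ (Fin 3)) → ℝ}
    {G : ℕ → ℝ → (EuclideanSpace ℝ (Fin 3)) → (EuclideanSpace ℝ (Fin 3)) →L[ℝ] (EuclideanSpace ℝ (Fin 3))}
    (hball : ∀ m k : ℕ, m ≤ k → IsSuitableWeakSolutionInBall ((2 : ℝ) ^ m) 0 (v k) (q k))
    (hbd : ∀ m k : ℕ, m ≤ k →
      typeIBound (parabolicCylinder ((2 : ℝ) ^ m) (0 : ℝ × (EuclideanSpace ℝ (Fin 3)))) (v k) (q k) (G k) ≤ I)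
    (hM : ∀ k : ℕ, ∀ᵐ w ∂(volume.restrict (parabolicCylinder ((2 : ℝ) ^ k) (0 : ℝ × (EuclideanSpace ℝ (Fin 3))))),
      ‖v k w.1 w.2‖ ≤ M) :
    ∃ (V : ℕ → ℝ → (EuclideanSpace ℝ (Fin 3)) → (EuclideanSpace ℝ (Fin 3))) (B : ℕ → ℕ → ℝ)
      (C α : ℕ → ℕ → ℝ≥0),
      (∀ m n, 0 < α m n) ∧
      (∀ k, uncurry (v k) =ᵐ[volume.restrict (parabolicCylinder ((2 : ℝ) ^ k) (0 : ℝ × (EuclideanSpace ℝ (Fin 3))))]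
        uncurry (V k)) ∧
      (∀ k, ContinuousOn (uncurry (V k)) (parabolicCylinder ((2 : ℝ) ^ k) (0 : ℝ × (EuclideanSpace ℝ (Fin 3))))) ∧
      (∀ k, ∀ w ∈ parabolicCylinder ((2 : ℝ) ^ k) (0 : ℝ × (EuclideanSpace ℝ (Fin 3))),
        ContDiffAt ℝ (⊤ : ℕ∞) (V k w.1) w.2) ∧
      (∀ m k : ℕ, m + 1 ≤ k → ∀ n : ℕ, ∀ w ∈ parabolicCylinder ((2 : ℝ) ^ m) (0 : ℝ × (EuclideanSpace ℝ (Fin 3))),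
        ‖iteratedFDeriv ℝ n (V k w.1) w.2‖ ≤ B m n) ∧
      (∀ m k : ℕ, m + 1 ≤ k → ∀ n : ℕ, HolderOnWith (C m n) (α m n)
        (fun w : ℝ × (EuclideanSpace ℝ (Fin 3)) => iteratedFDeriv ℝ n (V k w.1) w.2)
        (parabolicCylinder ((2 : ℝ) ^ m) (0 : ℝ × (EuclideanSpace ℝ (Fin 3))))) := by
  have hcc_pos : ∀ m : ℕ, (0 : ℝ) < (2 : ℝ) ^ m := fun m => by positivity
  have hcc_one : ∀ m : ℕ, (1 : ℝ) ≤ (2 : ℝ) ^ m := fun m => one_le_pow₀ (by norm_num)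
  have hcc_lt : ∀ m : ℕ, (2 : ℝ) ^ m < (2 : ℝ) ^ (m + 1) := fun m =>
    pow_lt_pow_right₀ (by norm_num) (Nat.lt_succ_self m)
  have hcc_mono : ∀ {m k : ℕ}, m ≤ k → (2 : ℝ) ^ m ≤ (2 : ℝ) ^ k := fun hmk =>
    pow_le_pow_right₀ (by norm_num) hmk
  -- normalised pressures
  set qn : ℕ → ℝ → (EuclideanSpace ℝ (Fin 3)) → ℝ :=
    fun k t x => q k t x - ⨍ y in ball (0 : (EuclideanSpace ℝ (Fin 3))) 1, q k t y with hqn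
  have hballn : ∀ m k : ℕ, m ≤ k → IsSuitableWeakSolutionInBall ((2 : ℝ) ^ m) 0 (v k) (qn k) :=
    fun m k hmk => isSuitableWeakSolutionInBall_sub_unitBallMean (hcc_one m) (hball m k hmk)
  have hdist : ∀ m k : ℕ, m ≤ k →
      IsDistributionalNSSolutionOn (parabolicCylinderOpens ((2 : ℝ) ^ m) (0 : ℝ × (EuclideanSpace ℝ (Fin 3))))
        1 0 (v k) (qn k) := fun m k hmk => (hballn m k hmk).1.distributional
  -- the pressure bounds of Step 1
  choose P hP using fun m : ℕ => exists_pressure_level_bound (G := G) hI hball hbd m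
  -- the a.e. bounds on sub-balls
  have hM' : ∀ m k : ℕ, m ≤ k →
      ∀ᵐ w ∂(volume.restrict (parabolicCylinder ((2 : ℝ) ^ m) (0 : ℝ × (EuclideanSpace ℝ (Fin 3))))),
        ‖v k w.1 w.2‖ ≤ M := fun m k hmk =>
    ae_restrict_of_ae_restrict_of_subset (parabolicCylinder_mono (hcc_pos m).le (hcc_mono hmk) _) (hM k)
  -- the higher-regularity fact at every level
  choose K C α hα hfact using fun m : ℕ => NSBoundedHigherRegularityBounds_holds ((2 : ℝ) ^ m) M (P m)
  -- the representatives: level `k` data for `v k`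
  have hrep : ∀ k : ℕ, ∃ V : ℝ → (EuclideanSpace ℝ (Fin 3)) → (EuclideanSpace ℝ (Fin 3)),
      uncurry (v k) =ᵐ[volume.restrict (parabolicCylinder ((2 : ℝ) ^ k) (0 : ℝ × (EuclideanSpace ℝ (Fin 3))))]
        uncurry V ∧
      (∀ w ∈ parabolicCylinder ((2 : ℝ) ^ k) (0 : ℝ × (EuclideanSpace ℝ (Fin 3))), ContDiffAt ℝ (⊤ : ℕ∞) (V w.1) w.2) ∧
      ∀ n : ℕ, ∀ r ∈ Ioo 0 ((2 : ℝ) ^ k),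
        HolderOnWith (C k n r) (α k n r) (fun w : ℝ × (EuclideanSpace ℝ (Fin 3)) => iteratedFDeriv ℝ n (V w.1) w.2)
          (parabolicCylinder r (0 : ℝ × (EuclideanSpace ℝ (Fin 3)))) ∧
        ∀ w ∈ parabolicCylinder r (0 : ℝ × (EuclideanSpace ℝ (Fin 3))), ‖iteratedFDeriv ℝ n (V w.1) w.2‖ ≤ K k n r :=
    fun k => hfact k (v k) (qn k) 0 (hdist k k le_rfl) (hM' k k le_rfl) (hP k k le_rfl)
  choose V hVae hVcd hVH using hrep
  -- the representatives at a fixed lower level (for the uniform bounds)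
  have hrep' : ∀ m k : ℕ, m + 1 ≤ k → ∃ W : ℝ → (EuclideanSpace ℝ (Fin 3)) → (EuclideanSpace ℝ (Fin 3)),
      uncurry (v k) =ᵐ[volume.restrict (parabolicCylinder ((2 : ℝ) ^ (m + 1)) (0 : ℝ × (EuclideanSpace ℝ (Fin 3))))]
        uncurry W ∧
      (∀ w ∈ parabolicCylinder ((2 : ℝ) ^ (m + 1)) (0 : ℝ × (EuclideanSpace ℝ (Fin 3))),
        ContDiffAt ℝ (⊤ : ℕ∞) (W w.1) w.2) ∧
      ∀ n : ℕ, ∀ r ∈ Ioo 0 ((2 : ℝ) ^ (m + 1)),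
        HolderOnWith (C (m + 1) n r) (α (m + 1) n r)
          (fun w : ℝ × (EuclideanSpace ℝ (Fin 3)) => iteratedFDeriv ℝ n (W w.1) w.2)
          (parabolicCylinder r (0 : ℝ × (EuclideanSpace ℝ (Fin 3)))) ∧
        ∀ w ∈ parabolicCylinder r (0 : ℝ × (EuclideanSpace ℝ (Fin 3))), ‖iteratedFDeriv ℝ n (W w.1) w.2‖ ≤ K (m + 1) n r :=
    fun m k hmk => hfact (m + 1) (v k) (qn k) 0 (hdist (m + 1) k hmk) (hM' (m + 1) k hmk) (hP (m + 1) k hmk)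
  -- continuity of the representatives
  have hVc : ∀ k, ContinuousOn (uncurry (V k)) (parabolicCylinder ((2 : ℝ) ^ k) (0 : ℝ × (EuclideanSpace ℝ (Fin 3)))) :=
    fun k => continuousOn_uncurry_of_holder_exhaustion fun r hr =>
      ⟨C k 0 r, α k 0 r, hα k 0 r hr, (hVH k 0 r hr).1⟩
  refine ⟨V, fun m n => (K (m + 1) n ((2 : ℝ) ^ m) : ℝ), fun m n => C (m + 1) n ((2 : ℝ) ^ m),
    fun m n => α (m + 1) n ((2 : ℝ) ^ m), fun m n => hα (m + 1) n _ ⟨hcc_pos m, hcc_lt m⟩, hVae, hVc, hVcd,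
    ?_, ?_⟩
  · -- sup bounds, through the level-`(m+1)` representative
    intro m k hmk n w hw
    obtain ⟨W, hWae, hWcd, hWH⟩ := hrep' m k hmk
    have hWc : ContinuousOn (uncurry W) (parabolicCylinder ((2 : ℝ) ^ (m + 1)) (0 : ℝ × (EuclideanSpace ℝ (Fin 3)))) :=
      continuousOn_uncurry_of_holder_exhaustion fun r hr =>
        ⟨C (m + 1) 0 r, α (m + 1) 0 r, hα (m + 1) 0 r hr, (hWH 0 r hr).1⟩
    have hsub : parabolicCylinder ((2 : ℝ) ^ (m + 1)) (0 : ℝ × (EuclideanSpace ℝ (Fin 3))) ⊆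
        parabolicCylinder ((2 : ℝ) ^ k) (0 : ℝ × (EuclideanSpace ℝ (Fin 3))) :=
      parabolicCylinder_mono (hcc_pos _).le (hcc_mono hmk) _
    have heq : EqOn (uncurry (V k)) (uncurry W)
        (parabolicCylinder ((2 : ℝ) ^ (m + 1)) (0 : ℝ × (EuclideanSpace ℝ (Fin 3)))) :=
      eqOn_of_ae_eq_of_continuousOn (isOpen_parabolicCylinder _ _)
        (ae_restrict_of_ae_restrict_of_subset hsub (hVae k)) hWae ((hVc k).mono hsub) hWc
    have hw' : w ∈ parabolicCylinder ((2 : ℝ) ^ (m + 1)) (0 : ℝ × (EuclideanSpace ℝ (Fin 3))) :=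
      parabolicCylinder_mono (hcc_pos m).le (hcc_lt m).le _ hw
    rw [iteratedFDeriv_eq_of_eqOn (isOpen_parabolicCylinder _ _) heq hw' n]
    exact (hWH n ((2 : ℝ) ^ m) ⟨hcc_pos m, hcc_lt m⟩).2 w hw
  · -- Hölder moduli, through the level-`(m+1)` representative
    intro m k hmk n
    obtain ⟨W, hWae, hWcd, hWH⟩ := hrep' m k hmk
    have hWc : ContinuousOn (uncurry W) (parabolicCylinder ((2 : ℝ) ^ (m + 1)) (0 : ℝ × (EuclideanSpace ℝ (Fin 3)))) :=
      continuousOn_uncurry_of_holder_exhaustion fun r hr =>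
        ⟨C (m + 1) 0 r, α (m + 1) 0 r, hα (m + 1) 0 r hr, (hWH 0 r hr).1⟩
    have hsub : parabolicCylinder ((2 : ℝ) ^ (m + 1)) (0 : ℝ × (EuclideanSpace ℝ (Fin 3))) ⊆
        parabolicCylinder ((2 : ℝ) ^ k) (0 : ℝ × (EuclideanSpace ℝ (Fin 3))) :=
      parabolicCylinder_mono (hcc_pos _).le (hcc_mono hmk) _
    have heq : EqOn (uncurry (V k)) (uncurry W)
        (parabolicCylinder ((2 : ℝ) ^ (m + 1)) (0 : ℝ × (EuclideanSpace ℝ (Fin 3)))) :=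
      eqOn_of_ae_eq_of_continuousOn (isOpen_parabolicCylinder _ _)
        (ae_restrict_of_ae_restrict_of_subset hsub (hVae k)) hWae ((hVc k).mono hsub) hWc
    have hH := (hWH n ((2 : ℝ) ^ m) ⟨hcc_pos m, hcc_lt m⟩).1
    intro w hw w' hw'
    have hwm : w ∈ parabolicCylinder ((2 : ℝ) ^ (m + 1)) (0 : ℝ × (EuclideanSpace ℝ (Fin 3))) :=
      parabolicCylinder_mono (hcc_pos m).le (hcc_lt m).le _ hw
    have hwm' : w' ∈ parabolicCylinder ((2 : ℝ) ^ (m + 1)) (0 : ℝ × (EuclideanSpace ℝ (Fin 3))) :=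
      parabolicCylinder_mono (hcc_pos m).le (hcc_lt m).le _ hw'
    simp only
    rw [iteratedFDeriv_eq_of_eqOn (isOpen_parabolicCylinder _ _) heq hwm n,
      iteratedFDeriv_eq_of_eqOn (isOpen_parabolicCylinder _ _) heq hwm' n]
    exact hH w hw w' hw'


/-! ### Step 4: diagonal Arzelà–Ascoli for the fields and their gradients -/

/-- Re-indexing a uniformly convergent family along a map tending to the index filter. [folklore] -/
private theorem tendstoUniformlyOn_comp_of_tendsto {ι ι' X Y : Type*} [UniformSpace Y] {F : ι → X → Y}
    {f : X → Y} {p : Filter ι} {s : Set X} (h : TendstoUniformlyOn F f p s) {l : Filter ι'}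
    {g : ι' → ι} (hg : Tendsto g l p) : TendstoUniformlyOn (fun j => F (g j)) f l s :=
  fun u hu => hg.eventually (h u hu)

/-- The slab piece `[−(n+2), −1/(n+2)] × B̄(0, n+2)` lies in the parabolic ball `Q(0, n+3)`. [folklore] -/
private theorem slabPiece_subset_parabolicCylinder (n : ℕ) :
    Icc (-((n : ℝ) + 2)) (-(1 / ((n : ℝ) + 2))) ×ˢ closedBall (0 : (EuclideanSpace ℝ (Fin 3))) ((n : ℝ) + 2) ⊆
      parabolicCylinder ((n : ℝ) + 3) (0 : ℝ × (EuclideanSpace ℝ (Fin 3))) := by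
  intro z hz
  obtain ⟨⟨h1, h2⟩, h3⟩ := mem_slabPiece.1 hz
  simp only [mem_parabolicCylinder, Prod.fst_zero, Prod.snd_zero, zero_sub, dist_zero_right]
  have hpos : (0 : ℝ) < 1 / ((n : ℝ) + 2) := by positivity
  refine ⟨⟨?_, by linarith⟩, by linarith⟩
  nlinarith [sq_nonneg ((n : ℝ) + 3)]

/-- `n + 3 ≤ 2^(n+2)` (real form). [folklore] -/
private theorem nat_add_three_le_two_pow (n : ℕ) : (n : ℝ) + 3 ≤ (2 : ℝ) ^ (n + 2) := by
  have h : n + 3 ≤ 2 ^ (n + 2) := by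
    have := Nat.lt_two_pow_self (n := n + 2)
    omega
  exact_mod_cast h

/-- The slab piece `n` lies in `Q(0, 2^(n+2))`. [folklore] -/
private theorem slabPiece_subset_parabolicCylinder_two_pow (n : ℕ) :
    Icc (-((n : ℝ) + 2)) (-(1 / ((n : ℝ) + 2))) ×ˢ closedBall (0 : (EuclideanSpace ℝ (Fin 3))) ((n : ℝ) + 2) ⊆
      parabolicCylinder ((2 : ℝ) ^ (n + 2)) (0 : ℝ × (EuclideanSpace ℝ (Fin 3))) :=
  (slabPiece_subset_parabolicCylinder n).trans
    (parabolicCylinder_mono (by positivity) (nat_add_three_le_two_pow n) _)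

/-- `fderiv` is the image of `iteratedFDeriv 1` under the currying isometry. [folklore] -/
private theorem fderiv_eq_curryFin1_iteratedFDeriv_one
    (f : (EuclideanSpace ℝ (Fin 3)) → (EuclideanSpace ℝ (Fin 3))) (x : (EuclideanSpace ℝ (Fin 3))) :
    fderiv ℝ f x = (continuousMultilinearCurryFin1 ℝ (EuclideanSpace ℝ (Fin 3))
      (EuclideanSpace ℝ (Fin 3))) (iteratedFDeriv ℝ 1 f x) :=
  ContinuousLinearMap.ext fun v => by
    rw [continuousMultilinearCurryFin1_apply, iteratedFDeriv_one_apply]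
    rfl

/-- A ball slice `{t} × B(x, 1)`, `t < 0`, lies in `Q(0, 2ᵏ)` for all large `k`. [folklore] -/
private theorem eventually_ball_slice_subset_parabolicCylinder {t : ℝ} (ht : t < 0) (x : (EuclideanSpace ℝ (Fin 3))) :
    ∀ᶠ k : ℕ in atTop, ∀ y ∈ ball x 1, ((t, y) : ℝ × (EuclideanSpace ℝ (Fin 3))) ∈
      parabolicCylinder ((2 : ℝ) ^ k) (0 : ℝ × (EuclideanSpace ℝ (Fin 3))) := by
  obtain ⟨n, hn⟩ := exists_singleton_prod_subset_slabPiece (E := EuclideanSpace ℝ (Fin 3)) ht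
    (isCompact_closedBall x 1)
  filter_upwards [eventually_ge_atTop (n + 2)] with k hk y hy
  refine parabolicCylinder_mono (by positivity) (pow_le_pow_right₀ (by norm_num) hk) _
    (slabPiece_subset_parabolicCylinder_two_pow n (hn ⟨rfl, ball_subset_closedBall hy⟩))

/-- **Diagonal Arzelà–Ascoli for a bounded local blow-up sequence: a `C¹` limit.** Given fields
`V k` continuous with smooth slices on `Q(0, 2ᵏ)` whose spatial derivatives of orders `0, 1` obey,
on every `Q(0, 2ᵐ)` and for all `k ≥ m + 1`, one sup bound and one Hölder modulus (the output of
`exists_representatives`), some subsequence converges at every point of the open slab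
`(−∞, 0) × ℝ³`, together with its spatial gradients, to a continuous field `W` with differentiable
slices: `V (ψ j)(t, x) → W(t, x)` and `∇V (ψ j)(t, x) → ∇W(t, x)` (Koch–Nadirashvili–Seregin–Šverák
2009, Lemma 6.1; Seregin–Šverák 2009, Thm. 2.8, p. 7: "a subsequence `{u^{k_j}}` of `{u^k}`
converges uniformly on compact subsets of `ℝⁿ × ]−∞, 0]`", here with the gradients).
[cite: SereginSverak2009, Thm 2.8 (p. 7; uniform convergence on compact subsets along the blow-up sequence); KochNadirashviliSereginSverak2009, Lemma 6.1] -/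
theorem exists_subseq_fderiv_limit
    {V : ℕ → ℝ → (EuclideanSpace ℝ (Fin 3)) → (EuclideanSpace ℝ (Fin 3))} {B : ℕ → ℕ → ℝ}
    {C α : ℕ → ℕ → ℝ≥0} (hα : ∀ m n, 0 < α m n)
    (hVc : ∀ k, ContinuousOn (uncurry (V k)) (parabolicCylinder ((2 : ℝ) ^ k) (0 : ℝ × (EuclideanSpace ℝ (Fin 3)))))
    (hVcd : ∀ k, ∀ w ∈ parabolicCylinder ((2 : ℝ) ^ k) (0 : ℝ × (EuclideanSpace ℝ (Fin 3))),
      ContDiffAt ℝ (⊤ : ℕ∞) (V k w.1) w.2)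
    (hB : ∀ m k : ℕ, m + 1 ≤ k → ∀ n : ℕ, ∀ w ∈ parabolicCylinder ((2 : ℝ) ^ m) (0 : ℝ × (EuclideanSpace ℝ (Fin 3))),
      ‖iteratedFDeriv ℝ n (V k w.1) w.2‖ ≤ B m n)
    (hH : ∀ m k : ℕ, m + 1 ≤ k → ∀ n : ℕ, HolderOnWith (C m n) (α m n)
      (fun w : ℝ × (EuclideanSpace ℝ (Fin 3)) => iteratedFDeriv ℝ n (V k w.1) w.2)
      (parabolicCylinder ((2 : ℝ) ^ m) (0 : ℝ × (EuclideanSpace ℝ (Fin 3))))) :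
    ∃ (ψ : ℕ → ℕ) (W : ℝ → (EuclideanSpace ℝ (Fin 3)) → (EuclideanSpace ℝ (Fin 3))), StrictMono ψ ∧
      ContinuousOn (uncurry W) (Iio 0 ×ˢ univ) ∧
      (∀ t < 0, ∀ x, DifferentiableAt ℝ (W t) x) ∧
      (∀ t < 0, ∀ x, Tendsto (fun j => V (ψ j) t x) atTop (𝓝 (W t x))) ∧
      (∀ t < 0, ∀ x, Tendsto (fun j => fderiv ℝ (V (ψ j) t) x) atTop (𝓝 (fderiv ℝ (W t) x))) := by
  -- shorthand for the pieces
  set T : ℕ → Set (ℝ × (EuclideanSpace ℝ (Fin 3))) := fun n =>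
    Icc (-((n : ℝ) + 2)) (-(1 / ((n : ℝ) + 2))) ×ˢ closedBall (0 : (EuclideanSpace ℝ (Fin 3))) ((n : ℝ) + 2) with hT
  have hTc : ∀ n, IsCompact (T n) := fun n => isCompact_slabPiece n
  have hTQ : ∀ n, T n ⊆ parabolicCylinder ((2 : ℝ) ^ (n + 2)) (0 : ℝ × (EuclideanSpace ℝ (Fin 3))) :=
    fun n => slabPiece_subset_parabolicCylinder_two_pow n
  have hQmono : ∀ {m k : ℕ}, m ≤ k → parabolicCylinder ((2 : ℝ) ^ m) (0 : ℝ × (EuclideanSpace ℝ (Fin 3))) ⊆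
      parabolicCylinder ((2 : ℝ) ^ k) (0 : ℝ × (EuclideanSpace ℝ (Fin 3))) := fun hmk =>
    parabolicCylinder_mono (by positivity) (pow_le_pow_right₀ (by norm_num) hmk) _
  -- ## first extraction: the fields
  have hV0 : ∀ n, ∀ᶠ k in atTop, ContinuousOn (uncurry (V k)) (T n) ∧
      (∀ z ∈ T n, ‖uncurry (V k) z‖ ≤ B (n + 2) 0) ∧
      ∀ z ∈ T n, ∀ z' ∈ T n, dist (uncurry (V k) z) (uncurry (V k) z') ≤
        (C (n + 2) 0 : ℝ) * dist z z' ^ (α (n + 2) 0 : ℝ) := by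
    intro n
    filter_upwards [eventually_ge_atTop (n + 3)] with k hk
    have hk' : n + 2 + 1 ≤ k := by omega
    refine ⟨(hVc k).mono ((hTQ n).trans (hQmono (by omega))), fun z hz => ?_, fun z hz z' hz' => ?_⟩
    · have h := hB (n + 2) k hk' 0 z (hTQ n hz)
      rwa [norm_iteratedFDeriv_zero] at h
    · have h := (hH (n + 2) k hk' 0).dist_le (hTQ n hz) (hTQ n hz')
      simp only [iteratedFDeriv_zero_eq_comp, comp_apply, LinearIsometryEquiv.dist_map] at h
      exact h
  obtain ⟨φ₁, hφ₁, W₀, hW₀⟩ := exists_strictMono_tendstoUniformlyOn_of_bound hTc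
    (fun n => (C (n + 2) 0).coe_nonneg) (fun n => hα (n + 2) 0) hV0
  -- ## second extraction: the gradients, along `φ₁`
  set F : ℕ → ℝ × (EuclideanSpace ℝ (Fin 3)) → ((EuclideanSpace ℝ (Fin 3)) →L[ℝ] (EuclideanSpace ℝ (Fin 3))) :=
    fun j z => fderiv ℝ (V (φ₁ j) z.1) z.2 with hF
  have hF0 : ∀ n, ∀ᶠ j in atTop, ContinuousOn (F j) (T n) ∧
      (∀ z ∈ T n, ‖F j z‖ ≤ B (n + 2) 1) ∧
      ∀ z ∈ T n, ∀ z' ∈ T n, dist (F j z) (F j z') ≤ (C (n + 2) 1 : ℝ) * dist z z' ^ (α (n + 2) 1 : ℝ) := by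
    intro n
    filter_upwards [eventually_ge_atTop (n + 3)] with j hj
    have hk' : n + 2 + 1 ≤ φ₁ j := by have h' : j ≤ φ₁ j := hφ₁.id_le j; omega
    refine ⟨?_, fun z hz => ?_, fun z hz z' hz' => ?_⟩
    · have hc : ContinuousOn (fun w : ℝ × (EuclideanSpace ℝ (Fin 3)) => iteratedFDeriv ℝ 1 (V (φ₁ j) w.1) w.2)
          (T n) := ((hH (n + 2) (φ₁ j) hk' 1).continuousOn (hα _ _)).mono (hTQ n)
      have he : F j = (fun M => (continuousMultilinearCurryFin1 ℝ (EuclideanSpace ℝ (Fin 3))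
          (EuclideanSpace ℝ (Fin 3))) M) ∘
          (fun w : ℝ × (EuclideanSpace ℝ (Fin 3)) => iteratedFDeriv ℝ 1 (V (φ₁ j) w.1) w.2) := by
        funext z; simp only [hF, comp_apply, fderiv_eq_curryFin1_iteratedFDeriv_one]
      rw [he]
      exact (continuousMultilinearCurryFin1 ℝ (EuclideanSpace ℝ (Fin 3))
        (EuclideanSpace ℝ (Fin 3))).continuous.comp_continuousOn hc
    · have h := hB (n + 2) (φ₁ j) hk' 1 z (hTQ n hz)
      rwa [norm_iteratedFDeriv_one] at h
    · have h := (hH (n + 2) (φ₁ j) hk' 1).dist_le (hTQ n hz) (hTQ n hz')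
      simp only [hF, fderiv_eq_curryFin1_iteratedFDeriv_one, LinearIsometryEquiv.dist_map]
      exact h
  obtain ⟨φ₂, hφ₂, W₁, hW₁⟩ := exists_strictMono_tendstoUniformlyOn_of_bound hTc
    (fun n => (C (n + 2) 1).coe_nonneg) (fun n => hα (n + 2) 1) hF0
  -- ## the diagonal subsequence and the limit
  set ψ : ℕ → ℕ := φ₁ ∘ φ₂ with hψ
  have hψ_mono : StrictMono ψ := hφ₁.comp hφ₂
  set W : ℝ → (EuclideanSpace ℝ (Fin 3)) → (EuclideanSpace ℝ (Fin 3)) := fun t x => W₀ (t, x) with hWdef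
  have hWunc : uncurry W = W₀ := by funext z; rfl
  have hconv0 : ∀ n, TendstoUniformlyOn (fun j => uncurry (V (ψ j))) W₀ atTop (T n) := fun n =>
    tendstoUniformlyOn_comp_of_tendsto (hW₀ n) hφ₂.tendsto_atTop
  have hconv1 : ∀ n, TendstoUniformlyOn (fun j => F (φ₂ j)) W₁ atTop (T n) := hW₁
  -- continuity of the limit
  have hcontV : ∀ n, ∀ᶠ j in atTop, ContinuousOn (uncurry (V (ψ j))) (T n) := fun n =>
    (hψ_mono.tendsto_atTop.eventually (hV0 n)).mono fun j hj => hj.1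
  have hWc : ContinuousOn (uncurry W) (Iio 0 ×ˢ univ) := by
    rw [hWunc]
    exact continuousOn_slab_of_tendstoUniformlyOn hcontV hconv0
  -- pointwise convergence of the fields
  have hpt : ∀ t < 0, ∀ x, Tendsto (fun j => V (ψ j) t x) atTop (𝓝 (W t x)) := fun t ht x =>
    tendsto_of_tendstoUniformlyOn_slabPiece hconv0 ht x
  -- the gradient of the limit
  have hderiv : ∀ t < 0, ∀ x, HasFDerivAt (W t) (W₁ (t, x)) x := by
    intro t ht x
    -- all slices at `t` are differentiable on `B(x, 1)` beyond some index
    obtain ⟨j₀, hj₀⟩ : ∃ j₀ : ℕ, ∀ j, j₀ ≤ j → ∀ y ∈ ball x 1,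
        ((t, y) : ℝ × (EuclideanSpace ℝ (Fin 3))) ∈
          parabolicCylinder ((2 : ℝ) ^ (ψ j)) (0 : ℝ × (EuclideanSpace ℝ (Fin 3))) := by
      have h := hψ_mono.tendsto_atTop.eventually (eventually_ball_slice_subset_parabolicCylinder ht x)
      obtain ⟨j₀, hj₀⟩ := h.exists_forall_of_atTop
      exact ⟨j₀, hj₀⟩
    have hdiff : ∀ j, ∀ y ∈ ball x 1,
        HasFDerivAt (V (ψ (j + j₀)) t) (F (φ₂ (j + j₀)) (t, y)) y := by
      intro j y hy
      have hmem := hj₀ (j + j₀) (Nat.le_add_left j₀ j) y hy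
      have hd : DifferentiableAt ℝ (V (ψ (j + j₀)) t) y :=
        (hVcd (ψ (j + j₀)) (t, y) hmem).differentiableAt (by simp)
      exact hd.hasFDerivAt
    have hF'conv : TendstoLocallyUniformlyOn (fun j y => F (φ₂ (j + j₀)) (t, y)) (fun y => W₁ (t, y)) atTop
        (ball x 1) := by
      have h1 : TendstoLocallyUniformly (fun j y => F (φ₂ j) (t, y)) (fun y => W₁ (t, y)) atTop :=
        tendstoLocallyUniformly_slice_of_tendstoUniformlyOn_slabPiece hconv1 ht
      have h2 : TendstoLocallyUniformly (fun j y => F (φ₂ (j + j₀)) (t, y)) (fun y => W₁ (t, y)) atTop := by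
        intro u hu y
        obtain ⟨s, hs, hev⟩ := h1 u hu y
        exact ⟨s, hs, (tendsto_add_atTop_nat j₀).eventually hev⟩
      exact h2.tendstoLocallyUniformlyOn
    have hfg : ∀ y ∈ ball x 1, Tendsto (fun j => V (ψ (j + j₀)) t y) atTop (𝓝 (W t y)) := fun y _ =>
      (tendsto_add_atTop_iff_nat j₀).2 (hpt t ht y)
    exact hasFDerivAt_of_tendstoLocallyUniformlyOn isOpen_ball hF'conv hdiff hfg (mem_ball_self one_pos)
  refine ⟨ψ, W, hψ_mono, hWc, fun t ht x => (hderiv t ht x).differentiableAt, hpt, fun t ht x => ?_⟩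
  rw [(hderiv t ht x).fderiv]
  exact tendsto_of_tendstoUniformlyOn_slabPiece hconv1 ht x


/-! ### Step 5: the `C¹` limit is the strong `L³` limit -/

/-- The open slab `(−∞, 0) × ℝ³` is exhausted by the parabolic balls `Q(0, 2ᵐ)`. [folklore] -/
private theorem slab_subset_iUnion_parabolicCylinder_two_pow :
    Iio (0 : ℝ) ×ˢ (univ : Set (EuclideanSpace ℝ (Fin 3))) ⊆
      ⋃ m : ℕ, parabolicCylinder ((2 : ℝ) ^ m) (0 : ℝ × (EuclideanSpace ℝ (Fin 3))) := by
  rintro ⟨t, x⟩ ⟨ht, -⟩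
  obtain ⟨n, hn⟩ := exists_mem_slabPiece (E := EuclideanSpace ℝ (Fin 3)) ht x
  exact mem_iUnion.2 ⟨n + 2, slabPiece_subset_parabolicCylinder_two_pow n hn⟩

/-- **The pointwise limit of the representatives is the strong `L³` limit**: if `v k → U` in
`L³(Q(0, R))` for every `R`, `v k = V k` a.e. on `Q(0, 2ᵏ)`, and `V (ψ j) → W` pointwise on the
open slab along a subsequence, then `U = W` a.e. on the slab (a.e.-convergent sub-subsequences and
uniqueness of limits). [folklore] -/
private theorem ae_eq_limit_of_tendsto_eLpNorm
    {v V : ℕ → ℝ → (EuclideanSpace ℝ (Fin 3)) → (EuclideanSpace ℝ (Fin 3))}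
    {U W : ℝ → (EuclideanSpace ℝ (Fin 3)) → (EuclideanSpace ℝ (Fin 3))} {ψ : ℕ → ℕ} (hψ : StrictMono ψ)
    (hVae : ∀ k, uncurry (v k) =ᵐ[volume.restrict (parabolicCylinder ((2 : ℝ) ^ k) (0 : ℝ × (EuclideanSpace ℝ (Fin 3))))]
      uncurry (V k))
    (hmeas : ∀ m k : ℕ, m ≤ k → AEStronglyMeasurable (uncurry (v k))
      (volume.restrict (parabolicCylinder ((2 : ℝ) ^ m) (0 : ℝ × (EuclideanSpace ℝ (Fin 3))))))
    (hUm : ∀ R : ℝ, 0 < R → AEStronglyMeasurable (uncurry U)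
      (volume.restrict (parabolicCylinder R (0 : ℝ × (EuclideanSpace ℝ (Fin 3))))))
    (hconv : ∀ R : ℝ, 0 < R → Tendsto (fun k => eLpNorm (uncurry (v k) - uncurry U) 3
      (volume.restrict (parabolicCylinder R (0 : ℝ × (EuclideanSpace ℝ (Fin 3)))))) atTop (𝓝 0))
    (hpt : ∀ t < 0, ∀ x, Tendsto (fun j => V (ψ j) t x) atTop (𝓝 (W t x))) :
    uncurry U =ᵐ[volume.restrict (Iio (0 : ℝ) ×ˢ (univ : Set (EuclideanSpace ℝ (Fin 3))))] uncurry W := by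
  refine ae_restrict_of_ae_restrict_of_subset slab_subset_iUnion_parabolicCylinder_two_pow ?_
  rw [ae_restrict_iUnion_iff]
  intro m
  set Q : Set (ℝ × (EuclideanSpace ℝ (Fin 3))) :=
    parabolicCylinder ((2 : ℝ) ^ m) (0 : ℝ × (EuclideanSpace ℝ (Fin 3))) with hQ
  have hQmono : ∀ {a b : ℕ}, a ≤ b → parabolicCylinder ((2 : ℝ) ^ a) (0 : ℝ × (EuclideanSpace ℝ (Fin 3))) ⊆
      parabolicCylinder ((2 : ℝ) ^ b) (0 : ℝ × (EuclideanSpace ℝ (Fin 3))) := fun hab =>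
    parabolicCylinder_mono (by positivity) (pow_le_pow_right₀ (by norm_num) hab) _
  -- the shifted subsequence `j ↦ v (ψ (j + m))` on `Q(0, 2ᵐ)`
  have hidx : ∀ j, m ≤ ψ (j + m) := fun j => (Nat.le_add_left m j).trans (hψ.id_le (j + m))
  have hL3 : Tendsto (fun j => eLpNorm (uncurry (v (ψ (j + m))) - uncurry U) 3 (volume.restrict Q)) atTop (𝓝 0) :=
    ((hconv _ (by positivity)).comp hψ.tendsto_atTop).comp (tendsto_add_atTop_nat m)
  have hin : TendstoInMeasure (volume.restrict Q) (fun j => uncurry (v (ψ (j + m)))) atTop (uncurry U) :=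
    tendstoInMeasure_of_tendsto_eLpNorm (by norm_num) (fun j => hmeas m _ (hidx j)) (hUm _ (by positivity)) hL3
  obtain ⟨ns, hns, hae⟩ := hin.exists_seq_tendsto_ae
  -- a.e. on `Q`: all the `v (ψ (j+m))` agree with their representatives
  have hagree : ∀ᵐ w ∂(volume.restrict Q), ∀ j, uncurry (v (ψ (j + m))) w = uncurry (V (ψ (j + m))) w := by
    rw [ae_all_iff]
    intro j
    exact ae_restrict_of_ae_restrict_of_subset (hQmono (hidx j)) (hVae (ψ (j + m)))
  have hmem : ∀ᵐ w ∂(volume.restrict Q), w ∈ Q := ae_restrict_mem (isOpen_parabolicCylinder _ _).measurableSet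
  filter_upwards [hae, hagree, hmem] with w h1 h2 h3
  have hw0 : w.1 < 0 := by
    have := (mem_parabolicCylinder.1 h3).1.2
    simpa using this
  have h4 : Tendsto (fun i => uncurry (V (ψ (ns i + m))) w) atTop (𝓝 (uncurry W w)) :=
    ((hpt w.1 hw0 w.2).comp (tendsto_add_atTop_nat m)).comp hns.tendsto_atTop
  have h5 : Tendsto (fun i => uncurry (V (ψ (ns i + m))) w) atTop (𝓝 (uncurry U w)) := by
    refine h1.congr fun i => ?_
    exact h2 (ns i)
  exact tendsto_nhds_unique h5 h4

/-! ### Step 6: assembly — representatives, subsequence, `C¹` limit, vorticity convergence -/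

/-- **Vorticity compactness of a bounded local blow-up sequence** (the `C¹_loc` content of the
compactness step in Seregin–Šverák 2009, Thm. 2.8 (p. 7) and Koch–Nadirashvili–Seregin–Šverák
2009, Lemma 6.1, for LOCAL suitable weak solutions on growing parabolic balls). Let `(v k, q k)` be
suitable weak solutions of Navier–Stokes (`ν = 1`) in `Q(0, 2ᵐ)` for all `m ≤ k`, with
`𝐈(Q(0, 2ᵐ)) ≤ I < ∞`, `|v k| ≤ M` a.e. on `Q(0, 2ᵏ)`, converging in `L³(Q(0, R))` for every `R`
to a field `U`. Then along a subsequence `ψ` the fields have representatives `V j` (`= v (ψ j)`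
a.e. on `Q(0, 2^{ψ j})`, continuous there with `C^∞` slices) converging at EVERY point `(t, x)`,
`t < 0`, together with their spatial gradients and hence their vorticities, to a continuous field
`W` with differentiable slices, and `W = U` a.e. on `(−∞, 0) × ℝ³`:
`V j (t, x) → W(t, x)`, `∇V j (t, x) → ∇W(t, x)`, `curl V j(t)(x) → curl W(t)(x)`.
[cite: SereginSverak2009, Thm 2.8 (p. 7) with its proof §2 p. 8; KochNadirashviliSereginSverak2009, Lemma 6.1] -/
theorem exists_subseq_curl_limit {I : ℝ≥0∞} (hI : I < ⊤) {M : ℝ}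
    {v : ℕ → ℝ → (EuclideanSpace ℝ (Fin 3)) → (EuclideanSpace ℝ (Fin 3))}
    {q : ℕ → ℝ → (EuclideanSpace ℝ (Fin 3)) → ℝ}
    {G : ℕ → ℝ → (EuclideanSpace ℝ (Fin 3)) → (EuclideanSpace ℝ (Fin 3)) →L[ℝ] (EuclideanSpace ℝ (Fin 3))}
    {U : ℝ → (EuclideanSpace ℝ (Fin 3)) → (EuclideanSpace ℝ (Fin 3))}
    (hball : ∀ m k : ℕ, m ≤ k → IsSuitableWeakSolutionInBall ((2 : ℝ) ^ m) 0 (v k) (q k))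
    (hbd : ∀ m k : ℕ, m ≤ k →
      typeIBound (parabolicCylinder ((2 : ℝ) ^ m) (0 : ℝ × (EuclideanSpace ℝ (Fin 3)))) (v k) (q k) (G k) ≤ I)
    (hM : ∀ k : ℕ, ∀ᵐ w ∂(volume.restrict (parabolicCylinder ((2 : ℝ) ^ k) (0 : ℝ × (EuclideanSpace ℝ (Fin 3))))),
      ‖v k w.1 w.2‖ ≤ M)
    (hUm : ∀ R : ℝ, 0 < R → AEStronglyMeasurable (uncurry U)
      (volume.restrict (parabolicCylinder R (0 : ℝ × (EuclideanSpace ℝ (Fin 3))))))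
    (hconv : ∀ R : ℝ, 0 < R → Tendsto (fun k => eLpNorm (uncurry (v k) - uncurry U) 3
      (volume.restrict (parabolicCylinder R (0 : ℝ × (EuclideanSpace ℝ (Fin 3)))))) atTop (𝓝 0)) :
    ∃ (ψ : ℕ → ℕ) (V : ℕ → ℝ → (EuclideanSpace ℝ (Fin 3)) → (EuclideanSpace ℝ (Fin 3)))
      (W : ℝ → (EuclideanSpace ℝ (Fin 3)) → (EuclideanSpace ℝ (Fin 3))), StrictMono ψ ∧
      (∀ j, uncurry (v (ψ j)) =ᵐ[volume.restrict (parabolicCylinder ((2 : ℝ) ^ (ψ j)) (0 : ℝ × (EuclideanSpace ℝ (Fin 3))))]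
        uncurry (V j)) ∧
      (∀ j, ContinuousOn (uncurry (V j)) (parabolicCylinder ((2 : ℝ) ^ (ψ j)) (0 : ℝ × (EuclideanSpace ℝ (Fin 3))))) ∧
      (∀ j, ∀ w ∈ parabolicCylinder ((2 : ℝ) ^ (ψ j)) (0 : ℝ × (EuclideanSpace ℝ (Fin 3))),
        ContDiffAt ℝ (⊤ : ℕ∞) (V j w.1) w.2) ∧
      uncurry U =ᵐ[volume.restrict (Iio (0 : ℝ) ×ˢ (univ : Set (EuclideanSpace ℝ (Fin 3))))] uncurry W ∧
      ContinuousOn (uncurry W) (Iio 0 ×ˢ univ) ∧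
      (∀ t < 0, ∀ x, DifferentiableAt ℝ (W t) x) ∧
      (∀ t < 0, ∀ x, Tendsto (fun j => V j t x) atTop (𝓝 (W t x))) ∧
      (∀ t < 0, ∀ x, Tendsto (fun j => fderiv ℝ (V j t) x) atTop (𝓝 (fderiv ℝ (W t) x))) ∧
      (∀ t < 0, ∀ x, Tendsto (fun j => curl (V j t) x) atTop (𝓝 (curl (W t) x))) := by
  obtain ⟨V, B, C, α, hα, hVae, hVc, hVcd, hB, hH⟩ := exists_representatives hI hball hbd hM
  obtain ⟨ψ, W, hψ, hWc, hWd, hpt, hfd⟩ := exists_subseq_fderiv_limit hα hVc hVcd hB hH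
  have hmeas : ∀ m k : ℕ, m ≤ k → AEStronglyMeasurable (uncurry (v k))
      (volume.restrict (parabolicCylinder ((2 : ℝ) ^ m) (0 : ℝ × (EuclideanSpace ℝ (Fin 3))))) :=
    fun m k hmk => (hball m k hmk).1.distributional.1.aestronglyMeasurable
  have hUW := ae_eq_limit_of_tendsto_eLpNorm hψ hVae hmeas hUm hconv hpt
  refine ⟨ψ, fun j => V (ψ j), W, hψ, fun j => hVae (ψ j), fun j => hVc (ψ j), fun j => hVcd (ψ j), hUW,
    hWc, hWd, hpt, hfd, fun t ht x => ?_⟩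
  simp only [curl_eq_curlCLM]
  exact (curlCLM.continuous.tendsto _).comp (hfd t ht x)

end Literature.Analysis.FluidPDE.LocalTypeIBlowup

end
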